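/-
Copyright: H21 programme, solo seat `solo-RiemannHypothesis-informed` (session 5).
-/
import Summits.RiemannHypothesis.RiemannHypothesis.Theorems.SoloInformedNearCount

/-!
# The phase of the cluster test near the pair, I (solo-informed, T37b preliminaries)

The un-dodged condition `|ĝ(ρ)|² ≤ ½|ĝ(ρ) − ĝ(1 − ρ̄)|²` of T37a (`SoloInformedMultiPair`) will
be verified (in `SoloInformedUndodgedNear`) for the cluster test `k = D₀ D_{S''} h_c` of T25/T33
at every point `ρ` within `δ₁` of the pair `½ ± η + iγ₀`.  This file supplies:

* the factorisation of the twisted transform, `ĝ(½ + u + iγ₀) = G(u) = (−u²)·C(u)·F(u)` with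
  the cluster symbol `C(u) = ∏_{ρ'' ∈ S''} (ρ'' − (½+u+iγ₀))(ρ'' − (½−u+iγ₀))` (even in `u`)
  and `F(u) = ∫ h_c e^{ut}` (odd in `u`), so that `ĝ(1 − ρ̄) = −G(ū)`
  (`weilMellin_clusterTest_twist`, `weilMellin_clusterTest_twist_reflect`, `clusterG_neg`);
* `|F(w) − F(η)| ≤ 24δ₁(c+1)|F(η)|` for `|w − η| ≤ δ₁` in the gain regime
  `2Φ(−η) ≤ e^{ηc}Φ(η)` (`norm_bumpDipoleF_sub_le_rel`);
* elementary facts: `|∏ zᵢ − 1| ≤ ∏(1 + |zᵢ − 1|) − 1`, and two points within relative distance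
  `1/7` of `f` satisfy `|x|² ≤ ½|x + y|²` (`sq_norm_le_half_sq_norm_add`).
-/

open MeasureTheory Complex Set Filter Topology Literature.NumberTheory.LFunctions
open scoped ContDiff ComplexConjugate

namespace Summit.RiemannHypothesis.RiemannHypothesis.Theorems

/-! ## Products close to one -/

/-- `|ab − 1| ≤ (1 + |a − 1|)(1 + |b − 1|) − 1`. -/
theorem norm_mul_sub_one_le (a b : ℂ) :
    ‖a * b - 1‖ ≤ (1 + ‖a - 1‖) * (1 + ‖b - 1‖) - 1 := by
  have e : a * b - 1 = (a - 1) * (b - 1) + (a - 1) + (b - 1) := by ring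
  rw [e]
  have h1 := norm_add_le ((a - 1) * (b - 1) + (a - 1)) (b - 1)
  have h2 := norm_add_le ((a - 1) * (b - 1)) (a - 1)
  rw [norm_mul] at h2
  nlinarith [norm_nonneg (a - 1), norm_nonneg (b - 1)]

/-- `|∏ zᵢ − 1| ≤ ∏ (1 + |zᵢ − 1|) − 1`. -/
theorem norm_prod_sub_one_le {ι : Type*} (s : Finset ι) (z : ι → ℂ) :
    ‖∏ i ∈ s, z i - 1‖ ≤ ∏ i ∈ s, (1 + ‖z i - 1‖) - 1 := by
  classical
  refine Finset.induction_on s (by simp) ?_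
  intro a s ha ih
  rw [Finset.prod_insert ha, Finset.prod_insert ha]
  have h := norm_mul_sub_one_le (z a) (∏ i ∈ s, z i)
  have hM : 0 ≤ 1 + ‖z a - 1‖ := by positivity
  have h2 : (1 + ‖z a - 1‖) * (1 + ‖∏ i ∈ s, z i - 1‖) ≤
      (1 + ‖z a - 1‖) * ∏ i ∈ s, (1 + ‖z i - 1‖) :=
    mul_le_mul_of_nonneg_left (by linarith) hM
  linarith

/-- Two points within relative distance `ε ≤ 1/7` of `f`: `|x|² ≤ ½|x + y|²`. -/
theorem sq_norm_le_half_sq_norm_add {x y f : ℂ} {ε : ℝ} (hx : ‖x - f‖ ≤ ε * ‖f‖)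
    (hy : ‖y - f‖ ≤ ε * ‖f‖) (hε : ε ≤ 1 / 7) : ‖x‖ ^ 2 ≤ ‖x + y‖ ^ 2 / 2 := by
  have hf := norm_nonneg f
  have h1 : ‖x‖ ≤ (1 + ε) * ‖f‖ := by
    have := norm_add_le (x - f) f
    rw [sub_add_cancel] at this
    linarith
  have h2 : (2 - 2 * ε) * ‖f‖ ≤ ‖x + y‖ := by
    have e : (2 : ℂ) * f = (x + y) - ((x - f) + (y - f)) := by ring
    have h3 : ‖(2 : ℂ) * f‖ ≤ ‖x + y‖ + ‖(x - f) + (y - f)‖ := by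
      rw [e]; exact norm_sub_le _ _
    have h4 := norm_add_le (x - f) (y - f)
    rw [norm_mul, Complex.norm_two] at h3
    linarith
  have h2' : 0 ≤ (2 - 2 * ε) * ‖f‖ := mul_nonneg (by linarith) hf
  have h1sq : ‖x‖ ^ 2 ≤ ((1 + ε) * ‖f‖) ^ 2 := pow_le_pow_left₀ (norm_nonneg _) h1 2
  have h2sq : ((2 - 2 * ε) * ‖f‖) ^ 2 ≤ ‖x + y‖ ^ 2 := pow_le_pow_left₀ h2' h2 2
  have hmid : ((1 + ε) * ‖f‖) ^ 2 ≤ ((2 - 2 * ε) * ‖f‖) ^ 2 / 2 := by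
    have hq : 0 ≤ 1 - 6 * ε + ε ^ 2 := by nlinarith
    nlinarith [mul_nonneg (sq_nonneg ‖f‖) hq]
  linarith

/-! ## The factorised transform of the cluster test -/

/-- For an odd `k`: `k̂(½ − w) = −k̂(½ + w)`. -/
theorem weilMellin_half_sub_of_odd {k : ℝ → ℂ} (hodd : ∀ t, k (-t) = -k t) (w : ℂ) :
    weilMellin k (1 / 2 - w) = -weilMellin k (1 / 2 + w) := by
  unfold weilMellin
  have h1 := integral_neg_eq_self (fun t : ℝ ↦ k t * cexp ((1 / 2 + w - 1 / 2) * t)) volume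
  rw [← h1, ← integral_neg]
  congr 1 with t
  rw [hodd, Complex.ofReal_neg]
  have e : cexp ((1 / 2 - w - 1 / 2) * (t : ℂ)) = cexp ((1 / 2 + w - 1 / 2) * -(t : ℂ)) := by
    congr 1; ring
  rw [e]
  ring

/-- The cluster symbol `C(u) = ∏_{ρ ∈ S} (ρ − (½+u+iγ₀))(ρ − (½−u+iγ₀))`. -/
noncomputable def clusterSym (γ₀ : ℝ) (S : Finset ℂ) (u : ℂ) : ℂ :=
  ∏ ρ ∈ S, ((ρ - (1 / 2 + u + γ₀ * I)) * (ρ - (1 / 2 - u + γ₀ * I)))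

/-- `G(u) = −u²·C(u)·∫ h_c e^{ut}`: the twisted transform of the cluster test at `½ + u + iγ₀`. -/
noncomputable def clusterG (ψ : ℝ → ℝ) (c γ₀ : ℝ) (S : Finset ℂ) (u : ℂ) : ℂ :=
  -u ^ 2 * clusterSym γ₀ S u * weilMellin (bumpDipole ψ c) (1 / 2 + u)

/-- `C` is even. -/
theorem clusterSym_neg (γ₀ : ℝ) (S : Finset ℂ) (u : ℂ) :
    clusterSym γ₀ S (-u) = clusterSym γ₀ S u := by
  unfold clusterSym
  refine Finset.prod_congr rfl fun ρ _ ↦ ?_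
  ring

/-- `G` is odd. -/
theorem clusterG_neg (ψ : ℝ → ℝ) (c γ₀ : ℝ) (S : Finset ℂ) (u : ℂ) :
    clusterG ψ c γ₀ S (-u) = -clusterG ψ c γ₀ S u := by
  unfold clusterG
  rw [clusterSym_neg, show (1 : ℂ) / 2 + -u = 1 / 2 - u by ring,
    weilMellin_half_sub_of_odd (bumpDipole_odd ψ c)]
  ring

variable {ψ : ℝ → ℝ}

/-- **Factorisation.**  For `k = D₀ D_{clusterList S} h_c`:
`ĝ(s) = ∫ k e^{(s−½−iγ₀)t} = G(s − iγ₀ − ½)`. -/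
theorem weilMellin_clusterTest_twist (hψ : ContDiff ℝ ∞ ψ) (hsupp : tsupport ψ ⊆ Icc (-1) 1)
    {c : ℝ} (hc : 0 ≤ c) (γ₀ : ℝ) (S : Finset ℂ) (s : ℂ) :
    weilMellin (fun t ↦ weilDodges (0 :: clusterList γ₀ S) (bumpDipole ψ c) t *
        cexp (-(γ₀ * I) * t)) s = clusterG ψ c γ₀ S (s - γ₀ * I - 1 / 2) := by
  have hh : IsWeilTest (bumpDipole ψ c) := isWeilTest_bumpDipole hψ hsupp hc
  rw [weilMellin_weilDodges_twist hh (0 :: clusterList γ₀ S) γ₀ s, List.map_cons, List.prod_cons,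
    clusterSymbol_eq, weilMellin_mul_cexp]
  unfold clusterG clusterSym
  have e : s + -(γ₀ * I) = 1 / 2 + (s - γ₀ * I - 1 / 2) := by ring
  rw [e]
  ring

/-- The reflected point: `ĝ(1 − ρ̄) = −G(ū)` for `u = ρ − iγ₀ − ½`. -/
theorem weilMellin_clusterTest_twist_reflect (hψ : ContDiff ℝ ∞ ψ)
    (hsupp : tsupport ψ ⊆ Icc (-1) 1) {c : ℝ} (hc : 0 ≤ c) (γ₀ : ℝ) (S : Finset ℂ) (ρ : ℂ) :
    weilMellin (fun t ↦ weilDodges (0 :: clusterList γ₀ S) (bumpDipole ψ c) t *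
        cexp (-(γ₀ * I) * t)) (1 - conj ρ) = -clusterG ψ c γ₀ S (conj (ρ - γ₀ * I - 1 / 2)) := by
  rw [weilMellin_clusterTest_twist hψ hsupp hc, ← clusterG_neg]
  congr 1
  simp only [map_sub, map_mul, Complex.conj_ofReal, Complex.conj_I, map_one, map_div₀,
    map_ofNat]
  ring

/-! ## The perturbation of `F(u) = ∫ h_c e^{ut}` -/

/-- `∫ |ψ| ≤ e^{η} Φ(η)` for `ψ ≥ 0` on `[−1, 1]`, `η ≥ 0`. -/
theorem integral_abs_le_exp_mul_bumpLaplace (hψ : Continuous ψ)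
    (hsupp : tsupport ψ ⊆ Icc (-1) 1) (hψ0 : ∀ s, 0 ≤ ψ s) {η : ℝ} (hη : 0 ≤ η) :
    ∫ s, |ψ s| ≤ Real.exp η * bumpLaplace ψ η := by
  unfold bumpLaplace
  rw [← integral_const_mul]
  have hψc : HasCompactSupport ψ := hasCompactSupport_of_tsupport_subset hsupp
  have hi : Integrable fun s ↦ Real.exp η * (ψ s * Real.exp (η * s)) := by
    have hcont : Continuous fun s ↦ Real.exp η * (ψ s * Real.exp (η * s)) := by fun_prop
    exact hcont.integrable_of_hasCompactSupport (hψc.mul_right.mul_left)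
  refine integral_mono_of_nonneg (Eventually.of_forall fun s ↦ abs_nonneg _) hi
    (Eventually.of_forall fun s ↦ ?_)
  by_cases hs : ψ s = 0
  · simp [hs]
  · have hs1 : -1 ≤ s :=
      (mem_Icc.mp (hsupp (subset_tsupport _ (Function.mem_support.mpr hs)))).1
    have he : 1 ≤ Real.exp η * Real.exp (η * s) := by
      rw [← Real.exp_add]
      exact Real.one_le_exp (by nlinarith)
    show |ψ s| ≤ Real.exp η * (ψ s * Real.exp (η * s))
    rw [abs_of_nonneg (hψ0 s)]
    nlinarith [hψ0 s]

/-- `F(u) = ∫ h_c(t) e^{ut} dt` as a `weilMellin` value. -/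
theorem weilMellin_bumpDipole_half_add (ψ : ℝ → ℝ) (c : ℝ) (u : ℂ) :
    weilMellin (bumpDipole ψ c) (1 / 2 + u) = ∫ t, bumpDipole ψ c t * cexp (u * t) := by
  unfold weilMellin
  congr 1 with t
  congr 2
  ring

/-- **`F` moves little near `η`.**  `|F(u) − F(η)| ≤ 2δ₁(c+1)e^{η(c+1)}·2∫|ψ|` for
`|u − η| ≤ δ₁`, `δ₁(c+1) ≤ 1`. -/
theorem norm_bumpDipoleF_sub_le (hψ : ContDiff ℝ ∞ ψ) (hsupp : tsupport ψ ⊆ Icc (-1) 1)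
    {c η δ₁ : ℝ} (hc : 0 ≤ c) (hη : 0 ≤ η) (hδ₁ : δ₁ * (c + 1) ≤ 1) {u : ℂ}
    (hu : ‖u - η‖ ≤ δ₁) :
    ‖weilMellin (bumpDipole ψ c) (1 / 2 + u) - weilMellin (bumpDipole ψ c) (1 / 2 + η)‖ ≤
      2 * δ₁ * (c + 1) * Real.exp (η * (c + 1)) * (2 * ∫ s, |ψ s|) := by
  rw [weilMellin_bumpDipole_half_add, weilMellin_bumpDipole_half_add]
  set h := bumpDipole ψ c with hh_def
  have hcont : Continuous h := (contDiff_bumpDipole hψ c).continuous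
  have hcs : HasCompactSupport h := hasCompactSupport_bumpDipole hsupp hc
  have hint : ∀ v : ℂ, Integrable fun t : ℝ ↦ h t * cexp (v * t) := fun v ↦
    (hcont.mul (by fun_prop)).integrable_of_hasCompactSupport hcs.mul_right
  rw [← integral_sub (hint u) (hint η)]
  have hδ0 : 0 ≤ δ₁ := le_trans (norm_nonneg _) hu
  have hc1 : 0 ≤ c + 1 := by linarith
  set K : ℝ := 2 * δ₁ * (c + 1) * Real.exp (η * (c + 1)) with hK
  have hK0 : 0 ≤ K :=
    mul_nonneg (mul_nonneg (mul_nonneg (by norm_num) hδ0) hc1) (Real.exp_nonneg _)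
  -- pointwise bound
  have hpt : ∀ t : ℝ, ‖h t * cexp (u * t) - h t * cexp ((η : ℂ) * t)‖ ≤ K * ‖h t‖ := by
    intro t
    by_cases ht : t ∈ Icc (-(c + 1)) (c + 1)
    · rw [← mul_sub, norm_mul]
      suffices hD : ‖cexp (u * t) - cexp ((η : ℂ) * t)‖ ≤ K by
        calc ‖h t‖ * ‖cexp (u * t) - cexp ((η : ℂ) * t)‖ ≤ ‖h t‖ * K :=
              mul_le_mul_of_nonneg_left hD (norm_nonneg _)
          _ = K * ‖h t‖ := mul_comm _ _
      have e : cexp (u * t) - cexp ((η : ℂ) * t) =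
          cexp ((η : ℂ) * t) * (cexp ((u - η) * t) - 1) := by
        rw [mul_sub, mul_one, ← Complex.exp_add]; congr 2; ring
      rw [e, norm_mul]
      have h1 : ‖cexp ((η : ℂ) * t)‖ ≤ Real.exp (η * (c + 1)) := by
        rw [Complex.norm_exp]
        simp only [Complex.mul_re, Complex.ofReal_re, Complex.ofReal_im, mul_zero, sub_zero]
        exact Real.exp_le_exp.mpr (mul_le_mul_of_nonneg_left (mem_Icc.mp ht).2 hη)
      have hz : ‖(u - η) * (t : ℂ)‖ ≤ δ₁ * (c + 1) := by
        rw [norm_mul, Complex.norm_real, Real.norm_eq_abs]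
        exact mul_le_mul hu (abs_le.mpr ⟨by linarith [(mem_Icc.mp ht).1], (mem_Icc.mp ht).2⟩)
          (abs_nonneg _) hδ0
      have h2 : ‖cexp ((u - η) * t) - 1‖ ≤ 2 * (δ₁ * (c + 1)) :=
        (Complex.norm_exp_sub_one_le (hz.trans hδ₁)).trans (by linarith)
      calc ‖cexp ((η : ℂ) * t)‖ * ‖cexp ((u - η) * t) - 1‖
          ≤ Real.exp (η * (c + 1)) * (2 * (δ₁ * (c + 1))) :=
            mul_le_mul h1 h2 (norm_nonneg _) (Real.exp_nonneg _)
        _ = K := by rw [hK]; ring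
    · have h0 : h t = 0 := by
        by_contra hne
        exact ht (support_bumpDipole_subset hsupp hc (Function.mem_support.mpr hne))
      simp [h0]
  have hnorm_int : Integrable fun t ↦ K * ‖h t‖ := (hcont.norm.integrable_of_hasCompactSupport
    hcs.norm).const_mul K
  calc ‖∫ t, (h t * cexp (u * t) - h t * cexp ((η : ℂ) * t))‖
      ≤ ∫ t, ‖h t * cexp (u * t) - h t * cexp ((η : ℂ) * t)‖ := norm_integral_le_integral_norm _
    _ ≤ ∫ t, K * ‖h t‖ := integral_mono_of_nonneg (Eventually.of_forall fun t ↦ norm_nonneg _)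
        hnorm_int (Eventually.of_forall hpt)
    _ = K * ∫ t, ‖h t‖ := integral_const_mul _ _
    _ ≤ K * (2 * ∫ s, |ψ s|) := by
        refine mul_le_mul_of_nonneg_left ?_ hK0
        have := integral_norm_iteratedDeriv_bumpDipole_le hψ hsupp c 0
        simpa only [iteratedDeriv_zero] using this

/-- **`F` moves little near `η`, relative form.**  In the gain regime `2Φ(−η) ≤ e^{ηc}Φ(η)`,
`η ≤ ½`: `|F(u) − F(η)| ≤ 24δ₁(c+1)|F(η)|` for `|u − η| ≤ δ₁`, `δ₁(c+1) ≤ 1`. -/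
theorem norm_bumpDipoleF_sub_le_rel (hψ : ContDiff ℝ ∞ ψ) (hsupp : tsupport ψ ⊆ Icc (-1) 1)
    (hψ0 : ∀ s, 0 ≤ ψ s) {c η δ₁ : ℝ} (hc : 0 ≤ c) (hη : 0 ≤ η) (hη2 : η ≤ 1 / 2)
    (hreg : 2 * bumpLaplace ψ (-η) ≤ Real.exp (η * c) * bumpLaplace ψ η)
    (hδ₁ : δ₁ * (c + 1) ≤ 1) {u : ℂ} (hu : ‖u - η‖ ≤ δ₁) :
    ‖weilMellin (bumpDipole ψ c) (1 / 2 + u) - weilMellin (bumpDipole ψ c) (1 / 2 + η)‖ ≤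
      24 * (δ₁ * (c + 1)) * ‖weilMellin (bumpDipole ψ c) (1 / 2 + η)‖ := by
  have h1 := norm_bumpDipoleF_sub_le hψ hsupp hc hη hδ₁ hu
  have h2 := integral_abs_le_exp_mul_bumpLaplace hψ.continuous hsupp hψ0 hη
  have hgain : Real.exp (η * c) * bumpLaplace ψ η - bumpLaplace ψ (-η) ≤
      ‖weilMellin (bumpDipole ψ c) (1 / 2 + η)‖ := by
    rw [weilMellin_bumpDipole_half_add]
    exact gain_bumpDipole hψ.continuous hsupp hψ0 hη hc
  have hΦ0 := bumpLaplace_nonneg hψ0 η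
  have hΦm := bumpLaplace_nonneg hψ0 (-η)
  have hδ0 : 0 ≤ δ₁ := le_trans (norm_nonneg _) hu
  have he3 : Real.exp (2 * η) ≤ 3 := by
    have := Real.exp_le_exp.mpr (show 2 * η ≤ 1 by linarith)
    linarith [Real.exp_one_lt_d9]
  have hsplit : Real.exp (η * (c + 1)) * Real.exp η = Real.exp (η * c) * Real.exp (2 * η) := by
    rw [← Real.exp_add, ← Real.exp_add]; congr 1; ring
  -- `2δ₁(c+1)e^{η(c+1)}·2·e^{η}Φ(η) = 4δ₁(c+1) e^{2η} (e^{ηc}Φ(η)) ≤ 24 δ₁(c+1) gain`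
  have hc1 : 0 ≤ c + 1 := by linarith
  have hA : 0 ≤ 2 * δ₁ * (c + 1) * Real.exp (η * (c + 1)) :=
    mul_nonneg (mul_nonneg (mul_nonneg (by norm_num) hδ0) hc1) (Real.exp_nonneg _)
  calc ‖weilMellin (bumpDipole ψ c) (1 / 2 + u) - weilMellin (bumpDipole ψ c) (1 / 2 + η)‖
      ≤ 2 * δ₁ * (c + 1) * Real.exp (η * (c + 1)) * (2 * (Real.exp η * bumpLaplace ψ η)) :=
        h1.trans (mul_le_mul_of_nonneg_left (by linarith) hA)
    _ = 4 * (δ₁ * (c + 1)) * Real.exp (2 * η) * (Real.exp (η * c) * bumpLaplace ψ η) := by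
        have : Real.exp (η * (c + 1)) * Real.exp η = Real.exp (η * c) * Real.exp (2 * η) :=
          hsplit
        calc 2 * δ₁ * (c + 1) * Real.exp (η * (c + 1)) * (2 * (Real.exp η * bumpLaplace ψ η))
            = 4 * (δ₁ * (c + 1)) * (Real.exp (η * (c + 1)) * Real.exp η) * bumpLaplace ψ η := by
              ring
          _ = _ := by rw [this]; ring
    _ ≤ 4 * (δ₁ * (c + 1)) * 3 * (2 * ‖weilMellin (bumpDipole ψ c) (1 / 2 + η)‖) := by
        have hg2 : Real.exp (η * c) * bumpLaplace ψ η ≤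
            2 * ‖weilMellin (bumpDipole ψ c) (1 / 2 + η)‖ := by linarith
        have h4 : 0 ≤ 4 * (δ₁ * (c + 1)) := mul_nonneg (by norm_num) (mul_nonneg hδ0 hc1)
        have hE : 0 ≤ Real.exp (η * c) * bumpLaplace ψ η := mul_nonneg (Real.exp_nonneg _) hΦ0
        calc 4 * (δ₁ * (c + 1)) * Real.exp (2 * η) * (Real.exp (η * c) * bumpLaplace ψ η)
            ≤ 4 * (δ₁ * (c + 1)) * 3 * (Real.exp (η * c) * bumpLaplace ψ η) :=
              mul_le_mul_of_nonneg_right (mul_le_mul_of_nonneg_left he3 h4) hE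
          _ ≤ _ := mul_le_mul_of_nonneg_left hg2 (mul_nonneg h4 (by norm_num))
    _ = 24 * (δ₁ * (c + 1)) * ‖weilMellin (bumpDipole ψ c) (1 / 2 + η)‖ := by ring

end Summit.RiemannHypothesis.RiemannHypothesis.Theorems
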